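import Summits.Ventures.PercRepro.CatHLocal
import Summits.Ventures.PercRepro.GluingBot

/-!
# Branch catalogues — bot is local; the modes (module 4)

Lemma 1 of the profile theorem (`isBot_iff_parts`, landed) instantiated: a configuration of the
gadget is `bot` iff every branch is locally bot and the branches' attachments of the centre agree
(`isBot_iff_local`); hence a configuration is in mode `μ` iff every branch is in a state allowed in
mode `μ` and, for `μ = some m'`, some branch attaches `m'` (`inMode_iff_allowed`).
-/

namespace PercRepro.CatGraph

open MultiGraph StarGadgetGraph

variable {C : Type} {BV BE : C → Type} {m : C → ℕ} (loc : ∀ τ, MultiGraph (Fin 4 ⊕ BV τ) (BE τ))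

/-- Distinct marks are distinct vertices. -/
theorem vm_ne {m₁ m₂ : Fin 3} (h : m₁ ≠ m₂) : (vm m₁ : CV BV m) ≠ vm m₂ := fun e => h (vm_inj.1 e)

/-- `localBot` as the three pairs. -/
theorem localBot_iff_three (τ : C) (s : BE τ → Bool) :
    localBot loc τ s ↔ ¬ (loc τ).Conn s (.inl 0) (.inl 1) ∧ ¬ (loc τ).Conn s (.inl 0) (.inl 2) ∧
      ¬ (loc τ).Conn s (.inl 1) (.inl 2) := by
  unfold localBot
  constructor
  · intro h
    exact ⟨h 0 1 (by decide), h 0 2 (by decide), h 1 2 (by decide)⟩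
  · rintro ⟨h01, h02, h12⟩ i j hne
    have h10 : ¬ (loc τ).Conn s (.inl 1) (.inl 0) := fun h => h01 h.symm
    have h20 : ¬ (loc τ).Conn s (.inl 2) (.inl 0) := fun h => h02 h.symm
    have h21 : ¬ (loc τ).Conn s (.inl 2) (.inl 1) := fun h => h12 h.symm
    fin_cases i <;> fin_cases j <;> simp_all

/-- Under `localBot`, a branch attaches at most one mark. -/
theorem attTo_unique {τ : C} {s : BE τ → Bool} (hL : localBot loc τ s) {m₁ m₂ : Fin 3}
    (h₁ : attTo loc τ s m₁) (h₂ : attTo loc τ s m₂) : m₁ = m₂ := by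
  by_contra hne
  exact hL m₁ m₂ hne (h₁.trans h₂.symm)

section WithInstances

variable [∀ τ, Fintype (BV τ)] [∀ τ, DecidableEq (BV τ)] [∀ τ, Fintype (BE τ)]

/-- Under `localBot`, `att s = some m'` iff the branch attaches `m'`. -/
theorem att_eq_some_iff {τ : C} {s : BE τ → Bool} (hL : localBot loc τ s) (m' : Fin 3) :
    att loc τ s = some m' ↔ attTo loc τ s m' := by
  unfold att
  constructor
  · intro h
    split_ifs at h with h0 h1 h2
    · exact Option.some.inj h ▸ h0
    · exact Option.some.inj h ▸ h1
    · exact Option.some.inj h ▸ h2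
  · intro h
    split_ifs with h0 h1 h2
    · rw [attTo_unique loc hL h0 h]
    · rw [attTo_unique loc hL h1 h]
    · rw [attTo_unique loc hL h2 h]
    · exact absurd h (by fin_cases m' <;> assumption)

/-- `att s = none` iff the branch attaches nothing. -/
theorem att_eq_none_iff {τ : C} (s : BE τ → Bool) : att loc τ s = none ↔ ∀ m', ¬ attTo loc τ s m' := by
  unfold att
  constructor
  · intro h m' hm
    split_ifs at h with h0 h1 h2
    · exact (by fin_cases m' <;> simp_all)
  · intro h
    simp [h 0, h 1, h 2]

end WithInstances

/-- **Lemma 1 instantiated**: `bot` iff every branch is locally bot and the attachments agree. -/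
theorem isBot_iff_local (S : Config (CE BE m)) :
    (catGadget loc m).IsBot S (vm 0) (vm 1) (vm 2) ↔
      (∀ b : Br m, localBot loc b.1 (brState S b)) ∧
        (∀ b b' : Br m, ∀ m₁ m₂ : Fin 3, attTo loc b.1 (brState S b) m₁ →
          attTo loc b'.1 (brState S b') m₂ → m₁ = m₂) := by
  have hCen : ∀ t ∈ Cen BV m, t = vm 0 ∨ t = vm 1 ∨ t = vm 2 ∨ t = vx := fun t ht =>
    cen_cases' t ht
  rw [(catGadget loc m).isBot_iff_parts S (Cen BV m) (vm 0) (vm 1) (vm 2) vx pe br (hpart loc m)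
    ⟨_, rfl⟩ ⟨_, rfl⟩ ⟨_, rfl⟩ ⟨_, rfl⟩ hCen (vm_ne (by decide)) (vm_ne (by decide))
    (vm_ne (by decide)) (vm_ne_vx 0).symm (vm_ne_vx 1).symm (vm_ne_vx 2).symm]
  constructor
  · rintro ⟨h1, h2⟩
    refine ⟨fun b => ?_, fun b b' m₁ m₂ ha hb => ?_⟩
    · rw [localBot_iff_three]
      obtain ⟨e01, e02, e12⟩ := h1 (some b)
      exact ⟨fun h => e01 ((connIn_iff_loc loc S b _ _).2 h), fun h => e02 ((connIn_iff_loc loc S b _ _).2 h),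
        fun h => e12 ((connIn_iff_loc loc S b _ _).2 h)⟩
    · by_contra hne
      have ha' := (connIn_vm_vx_iff loc S b m₁).2 ha
      have hb' := (connIn_vm_vx_iff loc S b' m₂).2 hb
      obtain ⟨e01, e02, e12⟩ := h2 (some b) (some b')
      obtain ⟨f01, f02, f12⟩ := h2 (some b') (some b)
      fin_cases m₁ <;> fin_cases m₂ <;> simp_all
  · rintro ⟨hL, hA⟩
    refine ⟨fun i => ?_, fun i j => ?_⟩
    · rcases i with _ | b
      · exact ⟨fun h => vm_ne (by decide) ((connIn_none_iff loc S _ _).1 h),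
          fun h => vm_ne (by decide) ((connIn_none_iff loc S _ _).1 h),
          fun h => vm_ne (by decide) ((connIn_none_iff loc S _ _).1 h)⟩
      · obtain ⟨e01, e02, e12⟩ := (localBot_iff_three loc b.1 _).1 (hL b)
        exact ⟨fun h => e01 ((connIn_iff_loc loc S b _ _).1 h),
          fun h => e02 ((connIn_iff_loc loc S b _ _).1 h), fun h => e12 ((connIn_iff_loc loc S b _ _).1 h)⟩
    · have key : ∀ (i : Option (Br m)) (m' : Fin 3), (catGadget loc m).ConnIn S pe i (vm m') vx →
          ∃ b, attTo loc b.1 (brState S b) m' := by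
        intro i m' h
        rcases i with _ | b
        · exact absurd ((connIn_none_iff loc S _ _).1 h) (vm_ne_vx m')
        · exact ⟨b, (connIn_vm_vx_iff loc S b m').1 h⟩
      refine ⟨fun ⟨h1, h2⟩ => ?_, fun ⟨h1, h2⟩ => ?_, fun ⟨h1, h2⟩ => ?_⟩
      · obtain ⟨b, hb⟩ := key i 0 h1; obtain ⟨b', hb'⟩ := key j 1 h2
        exact absurd (hA b b' 0 1 hb hb') (by decide)
      · obtain ⟨b, hb⟩ := key i 0 h1; obtain ⟨b', hb'⟩ := key j 2 h2
        exact absurd (hA b b' 0 2 hb hb') (by decide)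
      · obtain ⟨b, hb⟩ := key i 1 h1; obtain ⟨b', hb'⟩ := key j 2 h2
        exact absurd (hA b b' 1 2 hb hb') (by decide)

section WithInstances2

variable [∀ τ, Fintype (BV τ)] [∀ τ, DecidableEq (BV τ)] [∀ τ, Fintype (BE τ)]

/-- **Modes are allowed states plus a witness**: `InMode μ S` iff every branch is in a state allowed
in mode `μ` and, for `μ = some m'`, some branch attaches `m'`. -/
theorem inMode_iff_allowed (μ : Mode) (S : Config (CE BE m)) :
    InMode loc μ S ↔ (∀ b : Br m, allowedLoc loc μ b.1 (brState S b)) ∧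
      (∀ m', μ = some m' → ∃ b : Br m, att loc b.1 (brState S b) = some m') := by
  unfold InMode
  rw [isBot_iff_local]
  constructor
  · rintro ⟨⟨hL, hA⟩, hAtt⟩
    refine ⟨fun b => ⟨hL b, ?_⟩, fun m' hm => ?_⟩
    · rcases h : att loc b.1 (brState S b) with _ | m'
      · exact Or.inl rfl
      · right
        rw [(att_eq_some_iff loc (hL b) m')] at h
        exact ((hAtt m').1 ⟨b, h⟩).symm
    · obtain ⟨b, hb⟩ := (hAtt m').2 hm
      exact ⟨b, (att_eq_some_iff loc (hL b) m').2 hb⟩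
  · rintro ⟨hAl, hW⟩
    have hL : ∀ b : Br m, localBot loc b.1 (brState S b) := fun b => (hAl b).1
    have hatt : ∀ b : Br m, ∀ m', attTo loc b.1 (brState S b) m' → μ = some m' := by
      intro b m' h
      rcases (hAl b).2 with h0 | h0
      · rw [att_eq_none_iff] at h0
        exact absurd h (h0 m')
      · rw [← h0, att_eq_some_iff loc (hL b)]
        exact h
    refine ⟨⟨hL, fun b b' m₁ m₂ h₁ h₂ => ?_⟩, fun m' => ⟨fun ⟨b, hb⟩ => hatt b m' hb, fun hm => ?_⟩⟩
    · exact Option.some.inj ((hatt b m₁ h₁).symm.trans (hatt b' m₂ h₂))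
    · obtain ⟨b, hb⟩ := hW m' hm
      exact ⟨b, (att_eq_some_iff loc (hL b) m').1 hb⟩

end WithInstances2

end PercRepro.CatGraph
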